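import Summits.QuantumFields.YangMills.Theorems.LuscherReductionDressedRitzLiftLeakageResidual
import Summits.QuantumFields.YangMills.Theorems.LuscherReductionDressedRitzPolyakovLiftGlue
import Summits.QuantumFields.YangMills.Theorems.LuscherReductionDressedRitzPolyakovLiftRawVacuum
import HarnessLib

/-!
# Crux `DressedRitz` (stmt-QuantumFields-20205), line «polyakovlift», stub S-LEAK `stub_liftLeakage` — support III:
# press-buttons in the currency of the REGISTERED stub (skeleton rev 2, sha16 62fcf7b4f9c136d2; tree defs `PolyakovLift.*`)

Support module (fleet seat ym-20205-polyakovlift-s1; `--supports stmt-QuantumFields-20205`, helper, no closure claim).  Parts I–II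
(`…LiftLeakageForms.lean`, `…LiftLeakageResidual.lean`) showed, at fixed lattice, that clause (o4) for a physical vector `u` is EQUIVALENT to a
quasi-mode residual bound `∃ a, ‖K_βu − a·u‖² ≤ C(λ³/L²)λ₀²‖u‖²` and split the squared residual exactly into slow weights × levers plus a stiff
remainder.  This part states the consequences VERBATIM in the currency of the registered stub text

  `Stmt.stub_liftLeakage :≡ ∀ k, ∃ C lam0, 0 ≤ C ∧ 0 < lam0 ∧ ∀ lam ∈ (0, lam0], ∃ L0, ∀ L ≥ L0, ∀ β, InFemtoWindow lam β L →
     ∀ φ, IsRawVacuum β φ → ∀ ω g, LiftBasis (liftCoupling β L) k ω g → LeakageClause k C β (liftFamily β φ g)`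

(objects = the tree's `PolyakovLift.IsRawVacuum ∕ LiftBasis ∕ liftCoupling ∕ liftFamily ∕ LeakageClause`, `…PolyakovLiftDefs.lean` p523114), so
that the lead can discharge the stub by ONE term once the analytic input exists:

* `leakageClause_of_residual_named` — `PolyakovLift.LeakageClause k C β u` BY NAME from per-vector residual bounds (any physical family `u`);
* ★ `liftLeakage_of_residualLaw` — the stub text (character for character, as the conclusion) from the RESIDUAL LAW: same quantifier prefix,
  conclusion `∀ i, ∃ a, ‖K_β u_i − a·u_i‖² ≤ C(λ³/L²)λ₀²‖u_i‖²` for `u = liftFamily β φ g`;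
* ★★ `liftLeakage_of_vacuumResidualLaw` — the same where the analytic input is required ONLY at the Perron–Frobenius vacuum package
  (`VacDict.IsVacuum β Ω θ` with `Ω ≥ c > 0`: the positive vacuum with Jentzsch gap, for which the vacuum dictionary `VacDict.tendsto_ratio ∕
  tendsto_feynmanKac` is available); the passage to an arbitrary raw vacuum `φ = ±Ω` is the tree's `PolyakovLift.leakageClause_iff` (ym-infvol-p2 g6);
* ★★ `liftLeakage_of_vacuumSlowStiffLaw` — the same with the residual law replaced by the THREE-SECTOR law of Part II (for each `i`: an exact
  physical `l2`-orthonormal eigenfamily `ψ` of any length, an approximate eigenvalue `a`, and `Σ_j (λ_j − a)²⟨u_i,ψ_j⟩² + ‖(K_β − a)r_{i}‖² ≤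
  C(λ³/L²)λ₀²‖u_i‖²`, `r_i = u_i − Σ_j⟨u_i,ψ_j⟩ψ_j`).

WHAT REMAINS (not proved here, RG ∕ Born–Oppenheimer grade): the residual law itself — uniformly in the femto window, for EVERY one-site
eigen-ratio basis at `B₁ = 2/λ³`, the lifted flowed-Polyakov channel vectors are quasi-modes of `K_β` with relative squared residual `O(λ³/L²)`
(slow leakage weights `O(λ)` at levers `(λ/L)²`, stiff squared residual `O(λ³/L²)` = energy variance `O(λ³/ℓ²)` uniformly in the cutoff).
HONEST FRAMING: bookkeeping on the conditional femto rung R2b1; fixed-lattice; the stub stays OPEN; nothing here bears on infinite volume,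
the continuum limit or the Clay gap.  References: T. Kato, J. Phys. Soc. Japan 4 (1949) 334 [cite: Kato1949, §1]; M. Lüscher, NPB 219 (1983) 233
[cite: Luscher1983, §3]; M. Lüscher, U. Wolff, NPB 339 (1990) 222 [cite: LuscherWolff1990]; Reed–Simon IV Thm XIII.43–44 [cite: ReedSimonIV1978].
-/

set_option autoImplicit false

noncomputable section

open MeasureTheory Filter Topology Real Finset
open Literature.MathematicalPhysics.QuantumFieldTheory (GaugeConfig Site gaugeTransform)
open scoped BigOperators

namespace Summit.QuantumFields.YangMills.Theorems.FemtoTransferGap.LiftLeak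

open Summit.QuantumFields.YangMills.Theorems.FemtoTransferGap
open Summit.QuantumFields.YangMills.Theorems.FemtoTransferGap.PolyakovLift
open Summit.QuantumFields.YangMills.Theorems.FemtoTransferGap.VacDict

variable {L : ℕ} [NeZero L]

/-- **`PolyakovLift.LeakageClause` BY NAME from per-vector residual bounds** (any physical family). [cite: Kato1949, §1] -/
theorem leakageClause_of_residual_named {k : ℕ} (C β : ℝ) {u : Fin k → (GaugeConfig 3 L SU2 → ℝ)} (hu : ∀ i, IsPhys (u i))
    (h : ∀ i : Fin k, ∃ a : ℝ, l2 (transferApply β (u i) - a • u i) (transferApply β (u i) - a • u i) ≤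
      C * (luscherLambda β L ^ 3 / (L : ℝ) ^ 2) * levelValue su2Rep L β 0 ^ 2 * l2 (u i) (u i)) :
    LeakageClause k C β u :=
  leakageClause_of_residual C β hu h

/-- The lifted family of a lift basis at a raw vacuum is physical, member by member. [cite: Luscher2010, §2] -/
theorem isPhys_liftFamily {k : ℕ} (β : ℝ) {φ : GaugeConfig 3 L SU2 → ℝ} (hφ : IsPhys φ) {B : ℝ}
    {ω : GaugeConfig 3 1 SU2 → ℝ} {g : Fin k → (GaugeConfig 3 1 SU2 → ℝ)} (hb : LiftBasis B k ω g) (i : Fin k) :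
    IsPhys (liftFamily β φ g i) :=
  isPhys_liftVec β hφ (hb.2.2.2.2.1 i)

/-- ★ **S-LEAK from the RESIDUAL LAW.**  If, with the stub's quantifier prefix, every lifted channel vector `u_i = liftFamily β φ g i` admits an
approximate eigenvalue `a` with `‖K_βu_i − a·u_i‖² ≤ C(λ³/L²)λ₀²‖u_i‖²`, then the registered stub text `Stmt.stub_liftLeakage` holds (stated
here character for character as the conclusion; the lead closes the stub by `theorem stub_liftLeakage : Stmt.stub_liftLeakage :=
LiftLeak.liftLeakage_of_residualLaw h`). [cite: Kato1949, §1] [cite: Luscher1983, §3] -/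
theorem liftLeakage_of_residualLaw
    (h : ∀ k : ℕ, ∃ C lam0 : ℝ, 0 ≤ C ∧ 0 < lam0 ∧ ∀ lam : ℝ, 0 < lam → lam ≤ lam0 → ∃ L0 : ℕ,
      ∀ (L : ℕ) [NeZero L], L0 ≤ L → ∀ β : ℝ, InFemtoWindow lam β L →
        ∀ φ : GaugeConfig 3 L SU2 → ℝ, IsRawVacuum β φ →
          ∀ (ω : GaugeConfig 3 1 SU2 → ℝ) (g : Fin k → (GaugeConfig 3 1 SU2 → ℝ)), LiftBasis (liftCoupling β L) k ω g →
            ∀ i : Fin k, ∃ a : ℝ,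
              l2 (transferApply β (liftFamily β φ g i) - a • liftFamily β φ g i)
                  (transferApply β (liftFamily β φ g i) - a • liftFamily β φ g i) ≤
                C * (luscherLambda β L ^ 3 / (L : ℝ) ^ 2) * levelValue su2Rep L β 0 ^ 2 *
                  l2 (liftFamily β φ g i) (liftFamily β φ g i)) :
    ∀ k : ℕ, ∃ C lam0 : ℝ, 0 ≤ C ∧ 0 < lam0 ∧ ∀ lam : ℝ, 0 < lam → lam ≤ lam0 → ∃ L0 : ℕ,
      ∀ (L : ℕ) [NeZero L], L0 ≤ L → ∀ β : ℝ, InFemtoWindow lam β L →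
        ∀ φ : GaugeConfig 3 L SU2 → ℝ, IsRawVacuum β φ →
          ∀ (ω : GaugeConfig 3 1 SU2 → ℝ) (g : Fin k → (GaugeConfig 3 1 SU2 → ℝ)), LiftBasis (liftCoupling β L) k ω g →
            LeakageClause k C β (liftFamily β φ g) := by
  intro k
  obtain ⟨C, lam0, hC, hlam0, hk⟩ := h k
  refine ⟨C, lam0, hC, hlam0, fun lam hlam hle => ?_⟩
  obtain ⟨L0, hL⟩ := hk lam hlam hle
  refine ⟨L0, fun L _ hL0 β hW φ hφ ω g hb => ?_⟩
  exact leakageClause_of_residual C β (fun i => isPhys_liftFamily β hφ.1 hb i) (hL L hL0 β hW φ hφ ω g hb)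

/-- ★★ **S-LEAK from the residual law AT THE PERRON–FROBENIUS VACUUM ONLY.**  It suffices to establish the residual law for the lifted
vectors built on a vacuum PACKAGE `(Ω, θ)` (`VacDict.IsVacuum β Ω θ`: `‖Ω‖ = 1`, `K_βΩ = λ₀Ω`, Jentzsch gap `θ < λ₀`) with `Ω ≥ c > 0` pointwise —
the positive vacuum for which the vacuum dictionary is available; every raw vacuum is `±Ω` and the clause does not see the sign
(`PolyakovLift.leakageClause_iff`, `VacDict.exists_isVacuum`). [cite: ReedSimonIV1978, Thm XIII.43] [cite: Kato1949, §1] -/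
theorem liftLeakage_of_vacuumResidualLaw
    (h : ∀ k : ℕ, ∃ C lam0 : ℝ, 0 ≤ C ∧ 0 < lam0 ∧ ∀ lam : ℝ, 0 < lam → lam ≤ lam0 → ∃ L0 : ℕ,
      ∀ (L : ℕ) [NeZero L], L0 ≤ L → ∀ β : ℝ, InFemtoWindow lam β L →
        ∀ (Ω : physSubmodule L) (θ c : ℝ), IsVacuum β Ω θ → 0 < c → (∀ U, c ≤ (Ω : GaugeConfig 3 L SU2 → ℝ) U) →
          ∀ (ω : GaugeConfig 3 1 SU2 → ℝ) (g : Fin k → (GaugeConfig 3 1 SU2 → ℝ)), LiftBasis (liftCoupling β L) k ω g →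
            ∀ i : Fin k, ∃ a : ℝ,
              l2 (transferApply β (liftFamily β (Ω : GaugeConfig 3 L SU2 → ℝ) g i) - a • liftFamily β (Ω : GaugeConfig 3 L SU2 → ℝ) g i)
                  (transferApply β (liftFamily β (Ω : GaugeConfig 3 L SU2 → ℝ) g i) - a • liftFamily β (Ω : GaugeConfig 3 L SU2 → ℝ) g i) ≤
                C * (luscherLambda β L ^ 3 / (L : ℝ) ^ 2) * levelValue su2Rep L β 0 ^ 2 *
                  l2 (liftFamily β (Ω : GaugeConfig 3 L SU2 → ℝ) g i) (liftFamily β (Ω : GaugeConfig 3 L SU2 → ℝ) g i)) :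
    ∀ k : ℕ, ∃ C lam0 : ℝ, 0 ≤ C ∧ 0 < lam0 ∧ ∀ lam : ℝ, 0 < lam → lam ≤ lam0 → ∃ L0 : ℕ,
      ∀ (L : ℕ) [NeZero L], L0 ≤ L → ∀ β : ℝ, InFemtoWindow lam β L →
        ∀ φ : GaugeConfig 3 L SU2 → ℝ, IsRawVacuum β φ →
          ∀ (ω : GaugeConfig 3 1 SU2 → ℝ) (g : Fin k → (GaugeConfig 3 1 SU2 → ℝ)), LiftBasis (liftCoupling β L) k ω g →
            LeakageClause k C β (liftFamily β φ g) := by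
  intro k
  obtain ⟨C, lam0, hC, hlam0, hk⟩ := h k
  refine ⟨C, lam0, hC, hlam0, fun lam hlam hle => ?_⟩
  obtain ⟨L0, hL⟩ := hk lam hlam hle
  refine ⟨L0, fun L _ hL0 β hW φ hφ ω g hb => ?_⟩
  obtain ⟨Ω, θ, c, hV, hc, hcle⟩ := exists_isVacuum (L := L) β
  have hΩ : LeakageClause k C β (liftFamily β (Ω : GaugeConfig 3 L SU2 → ℝ) g) :=
    leakageClause_of_residual C β (fun i => isPhys_liftFamily β hV.raw.1 hb i) (hL L hL0 β hW Ω θ c hV hc hcle ω g hb)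
  exact (leakageClause_iff hV hφ C (fun i => flowLiftAt (L := L) 0 (flowTime β L) (g i))).2 hΩ

/-- ★★ **S-LEAK from the THREE-SECTOR law at the Perron–Frobenius vacuum.**  For each lifted vector `u_i` (built on the positive vacuum `Ω`):
an exact physical `l2`-orthonormal eigenfamily `ψ` (any length `N`, levels `λ_j`), an approximate eigenvalue `a`, and
`Σ_{j<N} (λ_j − a)²⟨u_i,ψ_j⟩² + ‖K_β r_i − a·r_i‖² ≤ C(λ³/L²)λ₀²‖u_i‖²`, `r_i = u_i − Σ_j ⟨u_i,ψ_j⟩ψ_j` — SLOW leakage weights × levers plus the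
STIFF squared residual (Part II `residual_split_eigenfamily`; eigenfamilies with Courant–Fischer domination from `exists_eigenfamily_dominating`,
stiff bound `remainder_residual_le`).  Then the registered stub text. [cite: Luscher1983, §3] [cite: LuscherWolff1990] [cite: Kato1949, §1] -/
theorem liftLeakage_of_vacuumSlowStiffLaw
    (h : ∀ k : ℕ, ∃ C lam0 : ℝ, 0 ≤ C ∧ 0 < lam0 ∧ ∀ lam : ℝ, 0 < lam → lam ≤ lam0 → ∃ L0 : ℕ,
      ∀ (L : ℕ) [NeZero L], L0 ≤ L → ∀ β : ℝ, InFemtoWindow lam β L →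
        ∀ (Ω : physSubmodule L) (θ c : ℝ), IsVacuum β Ω θ → 0 < c → (∀ U, c ≤ (Ω : GaugeConfig 3 L SU2 → ℝ) U) →
          ∀ (ω : GaugeConfig 3 1 SU2 → ℝ) (g : Fin k → (GaugeConfig 3 1 SU2 → ℝ)), LiftBasis (liftCoupling β L) k ω g →
            ∀ i : Fin k, ∃ (N : ℕ) (ψ : Fin N → (GaugeConfig 3 L SU2 → ℝ)) (ev : Fin N → ℝ) (a : ℝ),
              (∀ j, IsPhys (ψ j)) ∧ (∀ j l, l2 (ψ j) (ψ l) = if j = l then 1 else 0) ∧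
              (∀ j, transferApply β (ψ j) = ev j • ψ j) ∧
              ∑ j, (ev j - a) ^ 2 * l2 (liftFamily β (Ω : GaugeConfig 3 L SU2 → ℝ) g i) (ψ j) ^ 2 +
                l2 (transferApply β (liftFamily β (Ω : GaugeConfig 3 L SU2 → ℝ) g i -
                        ∑ j, l2 (liftFamily β (Ω : GaugeConfig 3 L SU2 → ℝ) g i) (ψ j) • ψ j) -
                      a • (liftFamily β (Ω : GaugeConfig 3 L SU2 → ℝ) g i -
                        ∑ j, l2 (liftFamily β (Ω : GaugeConfig 3 L SU2 → ℝ) g i) (ψ j) • ψ j))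
                  (transferApply β (liftFamily β (Ω : GaugeConfig 3 L SU2 → ℝ) g i -
                        ∑ j, l2 (liftFamily β (Ω : GaugeConfig 3 L SU2 → ℝ) g i) (ψ j) • ψ j) -
                      a • (liftFamily β (Ω : GaugeConfig 3 L SU2 → ℝ) g i -
                        ∑ j, l2 (liftFamily β (Ω : GaugeConfig 3 L SU2 → ℝ) g i) (ψ j) • ψ j))
                ≤ C * (luscherLambda β L ^ 3 / (L : ℝ) ^ 2) * levelValue su2Rep L β 0 ^ 2 *
                    l2 (liftFamily β (Ω : GaugeConfig 3 L SU2 → ℝ) g i) (liftFamily β (Ω : GaugeConfig 3 L SU2 → ℝ) g i)) :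
    ∀ k : ℕ, ∃ C lam0 : ℝ, 0 ≤ C ∧ 0 < lam0 ∧ ∀ lam : ℝ, 0 < lam → lam ≤ lam0 → ∃ L0 : ℕ,
      ∀ (L : ℕ) [NeZero L], L0 ≤ L → ∀ β : ℝ, InFemtoWindow lam β L →
        ∀ φ : GaugeConfig 3 L SU2 → ℝ, IsRawVacuum β φ →
          ∀ (ω : GaugeConfig 3 1 SU2 → ℝ) (g : Fin k → (GaugeConfig 3 1 SU2 → ℝ)), LiftBasis (liftCoupling β L) k ω g →
            LeakageClause k C β (liftFamily β φ g) := by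
  intro k
  obtain ⟨C, lam0, hC, hlam0, hk⟩ := h k
  refine ⟨C, lam0, hC, hlam0, fun lam hlam hle => ?_⟩
  obtain ⟨L0, hL⟩ := hk lam hlam hle
  refine ⟨L0, fun L _ hL0 β hW φ hφ ω g hb => ?_⟩
  obtain ⟨Ω, θ, c, hV, hc, hcle⟩ := exists_isVacuum (L := L) β
  have hΩ : LeakageClause k C β (liftFamily β (Ω : GaugeConfig 3 L SU2 → ℝ) g) :=
    leakageClause_of_slow_stiff C β (fun i => isPhys_liftFamily β hV.raw.1 hb i) (hL L hL0 β hW Ω θ c hV hc hcle ω g hb)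
  exact (leakageClause_iff hV hφ C (fun i => flowLiftAt (L := L) 0 (flowTime β L) (g i))).2 hΩ

end Summit.QuantumFields.YangMills.Theorems.FemtoTransferGap.LiftLeak

end
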